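import Summits.BirchSwinnertonDyer.BirchSwinnertonDyer.Theses.SchneiderFreeAdditiveX3
import HarnessLib

/-!
# Route `SchneiderFreeAdditiveX3` (rung K1 door, cell `bsd-schneider-ideate`), crux r2
# `PotMultBranchIMC` (item stmt-BirchSwinnertonDyer-19176): kernel-checked REDUCTIONS

Seat `bsd-schneider-door-c2` (prover), supporting — NOT closing — the crux
`Summit.BirchSwinnertonDyer.BirchSwinnertonDyer.Theses.SchneiderFreeAdditiveX3.PotMultBranchIMC`
(= T-B6-1♯ Manin-robust on the potentially multiplicative reducible cell (M):
`2·ord_p log_{ω_E} P ≤ ord_p f(0) + 2·v_p(c)` for a characteristic generator `f` of the Greenberg/BDP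
module `X_ac(E/K_∞)` at every anticyclotomic frame). The registered BC3 skeleton (planner g7, sha
f0502408…) splits the crux into `stub_charTorsion` (`X_ac` is `Λ`-torsion with `f(0) ≠ 0`) and
`stub_divisibilityLe` (the divisibility proper). This file proves, with no new statement and no fact
assumed beyond the route's own decls:

* `additiveIMCLowerBDPOnTreeLeAt_of_control_of_index_le` / `…_iff_index_le_of_control` — the
  CONVERSE of the tree's bookkeeping `SchneiderFree.index_le_slack_of_additive_links`: at one frame,
  GIVEN the control equality T-B6-2′ (`AdditiveControlOnTreeAt`), the slack-`s` link T-B6-1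
  (`AdditiveIMCLowerBDPOnTreeLeAt … s P`) is EQUIVALENT to the frame-free STEP-L inequality over `K`
  `2·ord_p[E(K):ℤP] ≤ ord_p #Ш(E/K)[p^∞] + ord_p ∏_{w∣N⁺} c_w(E/K) + 2s` (pure arithmetic).
* `stub_charTorsion_of_anticycControlAdditive` — the registered stub `stub_charTorsion` (signature
  verbatim) FOLLOWS from the sibling crux `AnticycControlAdditive` (item 19178): the control
  predicate already carries `∃ n, XAc.HasCharValuationAt … n` (torsion + `f(0) ≠ 0`), and the cell
  (M) lies in the census cell `SubSemistableTwist = SubM ∨ SubGordTwo`. So stub 1 is not an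
  independent obligation of the door: the crux's own content is `stub_divisibilityLe`.
* `potMultBranchIMC_of_anticycControlAdditive_of_divisibilityLe` — `AnticycControlAdditive` and the
  registered stub `stub_divisibilityLe` (signature verbatim, as a hypothesis) give the crux BY NAME.
* `potMultBranchIMC_of_anticycControlAdditive_of_indexLe` — `AnticycControlAdditive` and the
  STEP-L inequality over `K` in split currency at slack `v_p(Dt.c)` on the (M) data give the crux BY
  NAME (no frame needs to be produced in this direction). Together with `StepLManinLink` this says:
  modulo crux r4, crux r2 is exactly as strong as the (M) half of the target `StepLManin` read in
  `Ш[p^∞]` / split-Tamagawa currency — the decomposition loses nothing and gains nothing.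

Honest framing: nothing here proves the divisibility; Keller–Yin (arXiv:2410.23241 §0.2 p. 4, §0.5
p. 5, §3.1 p. 15) name the potentially multiplicative case open («due to the lack of tools of
studying Perrin-Riou's regulator map, we will not consider the potentially multiplicative case in
this work»; «(JLZmain) does not cover cases (II)»). BSD is not advanced by this file; it records the
logical shape of the door's crux r2 for the planner and the tribunal.

References: [JetchevSkinnerWan2017] §7.4.1 (arXiv:1512.06894 p. 30); [KellerYin2024PotOrd]
arXiv:2410.23241 §0.5; [LiuZhangZhang2018] Thm. 1.8.
-/

noncomputable section

open scoped Classical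

open WeierstrassCurve NumberField IsDedekindDomain Field Literature.NumberTheory.EllipticCurves
  Literature.NumberTheory.EllipticCurves.ModularForms
  Literature.NumberTheory.EllipticCurves.GreenbergSelmer
  Literature.NumberTheory.EllipticCurves.Rank1Residual
  Literature.NumberTheory.EllipticCurves.Rank1Residual.Typed
  Summit.BirchSwinnertonDyer.Rank1Residual
  Summit.BirchSwinnertonDyer.Rank1Residual.X11b
  Summit.BirchSwinnertonDyer.Rank1Residual.X11b.AcSelmer
  Summit.BirchSwinnertonDyer.Rank1Residual.X11b.Halves
  Summit.BirchSwinnertonDyer.BirchSwinnertonDyer.Theses.SchneiderFreeAdditiveX3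

set_option autoImplicit false
set_option linter.dupNamespace false

namespace Summit.BirchSwinnertonDyer.BirchSwinnertonDyer.Theorems.SchneiderFree

/-! ### One frame: T-B6-1 with slack ⟺ STEP L over `K`, given the control equality -/

section OneFrame

variable {p : ℕ} [Fact p.Prime] {K : Type} [Field K] [NumberField K]
  {W : WeierstrassCurve ℚ} [W.IsElliptic] [W.IsGloballyMinimal] {κ : ZpExtension K p}
  {𝔭 : HeightOneSpectrum (𝓞 K)} {γ : Field.absoluteGaloisGroup K} [Fact (κ.IsTopGenerator γ)]
  {ι : K →+* ℚ_[p]} {P : (W.baseChange K).toAffine.Point} {s : ℕ}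

/-- **Converse bookkeeping (one frame).** Given the control EQUALITY T-B6-2′
`ord_p f(0) = ord_p #Ш(E/K)[p^∞] + 2(ord_p log_ω P − ord_p[E(K):ℤP]) + ord_p ∏ c_w`, the frame-free
inequality `2·ord_p[E(K):ℤP] ≤ ord_p #Ш(E/K)[p^∞] + ord_p ∏ c_w + 2s` gives the slack-`s` link T-B6-1
`2·ord_p log_ω P ≤ ord_p f(0) + 2s` (with the SAME `n = ord_p f(0)` the control predicate supplies).
[cite: JetchevSkinnerWan2017, §7.4.1 (arXiv p. 30)] -/
theorem additiveIMCLowerBDPOnTreeLeAt_of_control_of_index_le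
    (h2 : AdditiveControlOnTreeAt p κ 𝔭 γ ι P)
    (hI : 2 * (padicValNat p (AddSubgroup.zmultiples P).index : ℤ) ≤
      (padicValNat p (Nat.card (AddCommGroup.primaryComponent (W.baseChange K).sha p)) : ℤ) +
        padicValNat p (X11b.tamagawaProductSplit W K) + 2 * (s : ℤ)) :
    AdditiveIMCLowerBDPOnTreeLeAt p κ 𝔭 γ ι s P := by
  obtain ⟨n, hn, heq⟩ := h2
  refine ⟨n, hn, ?_⟩
  omega

/-- **T-B6-1 with slack ⟺ STEP L over `K` (one frame), given T-B6-2′.** The forward direction is the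
tree's `index_le_slack_of_additive_links`; the backward one is
`additiveIMCLowerBDPOnTreeLeAt_of_control_of_index_le`. [cite: JetchevSkinnerWan2017, §7.4.1 (arXiv p. 30)] -/
theorem additiveIMCLowerBDPOnTreeLeAt_iff_index_le_of_control
    (h2 : AdditiveControlOnTreeAt p κ 𝔭 γ ι P) :
    AdditiveIMCLowerBDPOnTreeLeAt p κ 𝔭 γ ι s P ↔
      2 * (padicValNat p (AddSubgroup.zmultiples P).index : ℤ) ≤
        (padicValNat p (Nat.card (AddCommGroup.primaryComponent (W.baseChange K).sha p)) : ℤ) +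
          padicValNat p (X11b.tamagawaProductSplit W K) + 2 * (s : ℤ) :=
  ⟨fun h1 ↦ index_le_slack_of_additive_links h1 h2,
    fun hI ↦ additiveIMCLowerBDPOnTreeLeAt_of_control_of_index_le h2 hI⟩

/-- The control predicate alone already gives the torsion/valuation shape `∃ n, HasCharValuationAt … n`
(its first conjunct). [folklore] -/
theorem exists_hasCharValuationAt_of_control (h2 : AdditiveControlOnTreeAt p κ 𝔭 γ ι P) :
    ∃ n : ℕ, XAc.HasCharValuationAt (W.baseChange K) p κ 𝔭 ∅ γ n := by
  obtain ⟨n, hn, _⟩ := h2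
  exact ⟨n, hn⟩

end OneFrame

/-! ### The registered stub `stub_charTorsion` follows from crux r4 `AnticycControlAdditive` -/

/-- **`stub_charTorsion` ⇐ `AnticycControlAdditive`.** The first registered stub of the BC3 skeleton of
`PotMultBranchIMC` (signature verbatim: on cell (M), at every Heegner/parametrisation datum and every
anticyclotomic frame with `𝔭 ∣ p` of degree one, `X_ac(E/K_∞)` is `Λ`-torsion with a characteristic
generator of non-zero constant term) is implied by the route's control crux (item
stmt-BirchSwinnertonDyer-19178): `SubM ⊆ SubSemistableTwist` and `AdditiveControlOnTreeAt` carries the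
shape as its first conjunct. [folklore] -/
theorem stub_charTorsion_of_anticycControlAdditive
    (h4 : Summit.BirchSwinnertonDyer.BirchSwinnertonDyer.Theses.SchneiderFreeAdditiveX3.AnticycControlAdditive) :
    ∀ (W : WeierstrassCurve ℚ) [W.IsElliptic] [W.IsGloballyMinimal] (p : ℕ) [Fact p.Prime],
      W.analyticRank = 1 → p ≠ 2 → ClassX3 W p → Additive.SubM W p →
      ∀ (N : ℕ) [NeZero N] (K : Type) [Field K] [NumberField K]
        (Dt : ModularParametrizationData W N) (H : HeegnerDatum N (NumberField.discr K)) (ι : K →+* ℂ)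
        (P : (W.baseChange K).toAffine.Point),
        W.analyticRank = 1 → Additive.N10.Locus W p → W.conductorNorm ℤ = N → IsImaginaryQuadratic K →
        Odd (NumberField.discr K) → ¬ p ∣ Units.torsionOrder K → SatisfiesHeegnerHypothesis N K →
        (W.quadraticTwist (NumberField.discr K : ℚ)).entireLFunction 1 ≠ 0 →
        WeierstrassCurve.Affine.Point.map ι.toRatAlgHom P = heegnerPointComplex Dt H →
        ¬ IsOfFinAddOrder P →
        ∀ (κ : ZpExtension K p), κ.IsAnticyclotomic →
          ∀ (γ : Field.absoluteGaloisGroup K) [Fact (κ.IsTopGenerator γ)]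
            (𝔭 : HeightOneSpectrum (𝓞 K)) (h𝔭 : ((p : ℕ) : 𝓞 K) ∈ 𝔭.asIdeal)
            (he : 𝔭.asIdeal.ramificationIdx (𝓞 ℚ) = 1) (hf : 𝔭.asIdeal.inertiaDeg (𝓞 ℚ) = 1),
            ∃ n : ℕ, XAc.HasCharValuationAt (W.baseChange K) p κ 𝔭 ∅ γ n := by
  intro W _ _ p _ hr hp2 hX hS N _ K _ _ Dt H ι P hr' hloc hN hK hodd hunit hHe hL hP hnt κ hκ γ _ 𝔭 h𝔭 he hf
  have hS' : Additive.SubSemistableTwist W p := Or.inl hS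
  exact exists_hasCharValuationAt_of_control
    (h4 W p hr hp2 hX hS' N K Dt H ι P hr' hloc hN hK hodd hunit hHe hL hP hnt κ hκ γ 𝔭 h𝔭 he hf)

/-! ### The crux from crux r4 and the divisibility (stub 2), or from crux r4 and STEP L over `K` -/

/-- **`PotMultBranchIMC` ⇐ `AnticycControlAdditive` + `stub_divisibilityLe`.** With the control crux
supplying `n = ord_p f(0)` at every frame, the second registered stub (signature verbatim, carried as a
hypothesis: the divisibility `2·ord_p log_ω P ≤ n + 2·v_p(c)`, NONE in print) gives the crux by name.
[cite: KellerYin2024PotOrd, arXiv:2410.23241 §0.5 (the potentially multiplicative case is not treated)] -/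
theorem potMultBranchIMC_of_anticycControlAdditive_of_divisibilityLe
    (h4 : Summit.BirchSwinnertonDyer.BirchSwinnertonDyer.Theses.SchneiderFreeAdditiveX3.AnticycControlAdditive)
    (hdiv :
    ∀ (W : WeierstrassCurve ℚ) [W.IsElliptic] [W.IsGloballyMinimal] (p : ℕ) [Fact p.Prime],
      W.analyticRank = 1 → p ≠ 2 → ClassX3 W p → Additive.SubM W p →
      ∀ (N : ℕ) [NeZero N] (K : Type) [Field K] [NumberField K]
        (Dt : ModularParametrizationData W N) (H : HeegnerDatum N (NumberField.discr K)) (ι : K →+* ℂ)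
        (P : (W.baseChange K).toAffine.Point),
        W.analyticRank = 1 → Additive.N10.Locus W p → W.conductorNorm ℤ = N → IsImaginaryQuadratic K →
        Odd (NumberField.discr K) → ¬ p ∣ Units.torsionOrder K → SatisfiesHeegnerHypothesis N K →
        (W.quadraticTwist (NumberField.discr K : ℚ)).entireLFunction 1 ≠ 0 →
        WeierstrassCurve.Affine.Point.map ι.toRatAlgHom P = heegnerPointComplex Dt H →
        ¬ IsOfFinAddOrder P →
        ∀ (κ : ZpExtension K p), κ.IsAnticyclotomic →
          ∀ (γ : Field.absoluteGaloisGroup K) [Fact (κ.IsTopGenerator γ)]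
            (𝔭 : HeightOneSpectrum (𝓞 K)) (h𝔭 : ((p : ℕ) : 𝓞 K) ∈ 𝔭.asIdeal)
            (he : 𝔭.asIdeal.ramificationIdx (𝓞 ℚ) = 1) (hf : 𝔭.asIdeal.inertiaDeg (𝓞 ℚ) = 1),
            ∀ n : ℕ, XAc.HasCharValuationAt (W.baseChange K) p κ 𝔭 ∅ γ n →
              2 * X11b.padicLogOrd W p (embAt K p 𝔭 h𝔭 he hf) P ≤
                (n : ℤ) + 2 * (padicValNat p Dt.c.natAbs : ℤ)) :
    Summit.BirchSwinnertonDyer.BirchSwinnertonDyer.Theses.SchneiderFreeAdditiveX3.PotMultBranchIMC := by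
  intro W _ _ p _ hr hp2 hX hS N _ K _ _ Dt H ι P hr' hloc hN hK hodd hunit hHe hL hP hnt κ hκ γ _ 𝔭 h𝔭 he hf
  obtain ⟨n, hn⟩ := stub_charTorsion_of_anticycControlAdditive h4 W p hr hp2 hX hS N K Dt H ι P hr'
    hloc hN hK hodd hunit hHe hL hP hnt κ hκ γ 𝔭 h𝔭 he hf
  exact ⟨n, hn, hdiv W p hr hp2 hX hS N K Dt H ι P hr' hloc hN hK hodd hunit hHe hL hP hnt κ hκ γ 𝔭 h𝔭 he
    hf n hn⟩

/-- **`PotMultBranchIMC` ⇐ `AnticycControlAdditive` + STEP L over `K` (split currency) on cell (M).**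
If, on the (M) data of the door, the frame-free inequality
`2·ord_p[E(K):ℤP] ≤ ord_p #Ш(E/K)[p^∞] + ord_p ∏_{w∣N⁺} c_w(E/K) + 2·v_p(Dt.c)` holds, then the control
crux turns it into the crux at EVERY frame (converse bookkeeping; no frame has to be produced in this
direction). With `StepLManinLink` (crux r2 ∧ r3 ∧ r4 ⟹ target) this places crux r2, modulo crux r4,
at exactly the strength of the (M) half of STEP L. [cite: JetchevSkinnerWan2017, §7.4.1 (arXiv p. 30)] -/
theorem potMultBranchIMC_of_anticycControlAdditive_of_indexLe
    (h4 : Summit.BirchSwinnertonDyer.BirchSwinnertonDyer.Theses.SchneiderFreeAdditiveX3.AnticycControlAdditive)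
    (hI :
    ∀ (W : WeierstrassCurve ℚ) [W.IsElliptic] [W.IsGloballyMinimal] (p : ℕ) [Fact p.Prime],
      W.analyticRank = 1 → p ≠ 2 → ClassX3 W p → Additive.SubM W p →
      ∀ (N : ℕ) [NeZero N] (K : Type) [Field K] [NumberField K]
        (Dt : ModularParametrizationData W N) (H : HeegnerDatum N (NumberField.discr K)) (ι : K →+* ℂ)
        (P : (W.baseChange K).toAffine.Point),
        W.analyticRank = 1 → Additive.N10.Locus W p → W.conductorNorm ℤ = N → IsImaginaryQuadratic K →
        Odd (NumberField.discr K) → ¬ p ∣ Units.torsionOrder K → SatisfiesHeegnerHypothesis N K →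
        (W.quadraticTwist (NumberField.discr K : ℚ)).entireLFunction 1 ≠ 0 →
        WeierstrassCurve.Affine.Point.map ι.toRatAlgHom P = heegnerPointComplex Dt H →
        ¬ IsOfFinAddOrder P →
        2 * (padicValNat p (AddSubgroup.zmultiples P).index : ℤ) ≤
          (padicValNat p (Nat.card (AddCommGroup.primaryComponent (W.baseChange K).sha p)) : ℤ) +
            padicValNat p (X11b.tamagawaProductSplit W K) + 2 * (padicValNat p Dt.c.natAbs : ℤ)) :
    Summit.BirchSwinnertonDyer.BirchSwinnertonDyer.Theses.SchneiderFreeAdditiveX3.PotMultBranchIMC := by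
  intro W _ _ p _ hr hp2 hX hS N _ K _ _ Dt H ι P hr' hloc hN hK hodd hunit hHe hL hP hnt κ hκ γ _ 𝔭 h𝔭 he hf
  have hS' : Additive.SubSemistableTwist W p := Or.inl hS
  exact additiveIMCLowerBDPOnTreeLeAt_of_control_of_index_le
    (h4 W p hr hp2 hX hS' N K Dt H ι P hr' hloc hN hK hodd hunit hHe hL hP hnt κ hκ γ 𝔭 h𝔭 he hf)
    (hI W p hr hp2 hX hS N K Dt H ι P hr' hloc hN hK hodd hunit hHe hL hP hnt)

end Summit.BirchSwinnertonDyer.BirchSwinnertonDyer.Theorems.SchneiderFree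

end
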